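import Summits.CriticalPhenomena.PercolationContinuityZ3.Theorems.Transplant.FKConnectivityAllQSPWagner
import HarnessLib

/-!
# Connectivity correlation inequalities for `φ_{w,q}`, every `q > 0` — file 15: two-terminal series–parallel networks are closed under
# APEX ADDITION (the 2-tree step), so every 2-tree is a two-terminal series–parallel network between the endpoints of each of its edges

Support file (`--supports stmt-CriticalPhenomena-4575`), FK sub-lane `prim-bschramm-fk-2` (gen 7) of the post-continuity
programme; builds on p205010 (kernel theorem, internal audit signed; external expert review pending).  No definitions, no named
facts, no sorries; standard axioms.  Pure combinatorics of the class `FK.IsTTSP` (`…AllQSPDefs.lean`):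

* `FK.IsTTSP.subdivide_parallel` — if `E` is a two-terminal series–parallel network between `s, t`, `uv ∈ E` and `x` is a fresh
  vertex, then `E ∪ {ux, xv}` (a path of length two added ACROSS the edge `uv`, i.e. the 2-tree / apex step at `uv`) is again a
  two-terminal series–parallel network between `s, t` (induction on the network: at the leaf `uv` the edge becomes `uv ∥ (ux ∘ xv)`).
* `FK.IsTTSP.apex_terminal` — with the same data, `E ∪ {ux, xv}` is also a two-terminal series–parallel network between `u` and the
  NEW vertex `x` (`ux ∥ (xv ∘ E)`, `E` read from `v` to `u`).
Consequently every edge set generated from a single edge by apex steps (a 2-TREE, the class `IsTwoTree` of the sibling line fk-1 g5,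
`…AllQTwoTree.lean`) is an `IsTTSP` network between the two endpoints of EACH of its edges, so the theorems of `…AllQSPWagner.lean`
(EC⁺ / monotonicity in the parameters / pairwise positive correlation / hub inequality for every `q > 0`, edge-negative association for
`q < 1`) apply to every pair of a 2-tree support; the five-line induction on `IsTwoTree` is left to the file that imports both classes.
(Wald–Colbourn 1983: the subgraphs of 2-trees are exactly the `K₄`-minor-free graphs; Duffin 1965; neither is formalised here.)
[cite: Wagner2006, §5.3] [cite: Grimmett2006, §3.8 (pp. 61–62)]
-/

namespace Summit.CriticalPhenomena.PercolationContinuityZ3.Theorems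

namespace FK

open scoped Classical

variable {V : Type*}

/-- Spanned vertices of a union with the apex path: a vertex on an edge of `E ∪ {ux, xv}` lies on an edge of `E` or is one of
`u, x, v`. [folklore] -/
theorem mem_span_union_apex {E : Finset (Sym2 V)} {u v x z : V}
    (hz : ∃ e ∈ E ∪ ({s(u, x)} ∪ {s(x, v)}), z ∈ e) : (∃ e ∈ E, z ∈ e) ∨ z = u ∨ z = x ∨ z = v := by
  obtain ⟨e, he, hze⟩ := hz
  rcases Finset.mem_union.1 he with he | he
  · exact Or.inl ⟨e, he, hze⟩
  · rcases Finset.mem_union.1 he with he | he <;> rw [Finset.mem_singleton] at he <;> subst he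
    · rcases Sym2.mem_iff.1 hze with rfl | rfl
      · exact Or.inr (Or.inl rfl)
      · exact Or.inr (Or.inr (Or.inl rfl))
    · rcases Sym2.mem_iff.1 hze with rfl | rfl
      · exact Or.inr (Or.inr (Or.inl rfl))
      · exact Or.inr (Or.inr (Or.inr rfl))

/-- **The apex step preserves two-terminal series–parallel networks**: for `uv ∈ E` and a fresh vertex `x`, `E ∪ {ux, xv}` is again
a two-terminal series–parallel network between the same terminals. [folklore] -/
theorem IsTTSP.subdivide_parallel {E : Finset (Sym2 V)} {s t : V} (h : IsTTSP E s t) :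
    ∀ {u v x : V}, s(u, v) ∈ E → (∀ e ∈ E, x ∉ e) → IsTTSP (E ∪ ({s(u, x)} ∪ {s(x, v)})) s t := by
  induction h with
  | @edge s t hst =>
    intro u v x huv hx
    rw [Finset.mem_singleton] at huv
    have hxs : x ≠ s := fun h => hx _ (Finset.mem_singleton_self _) (h ▸ Sym2.mem_mk_left s t)
    have hxt : x ≠ t := fun h => hx _ (Finset.mem_singleton_self _) (h ▸ Sym2.mem_mk_right s t)
    -- the path `u – x – v` joins `s` and `t`
    have hpath : IsTTSP ({s(u, x)} ∪ {s(x, v)}) s t := by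
      rcases Sym2.eq_iff.1 huv with ⟨rfl, rfl⟩ | ⟨rfl, rfl⟩
      · exact IsTTSP.path₂ hxs.symm hxt hst
      · have hp := (IsTTSP.path₂ hxt.symm hxs hst.symm).symm
        exact hp
    refine IsTTSP.parallel (IsTTSP.edge hst) hpath ?_ fun z hz₁ hz₂ => ?_
    · rw [Finset.disjoint_singleton_left, Finset.mem_union, Finset.mem_singleton, Finset.mem_singleton, not_or]
      constructor
      · intro h
        have hx' : x ∈ s(s, t) := h ▸ Sym2.mem_mk_right u x
        rcases Sym2.mem_iff.1 hx' with h' | h'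
        · exact hxs h'
        · exact hxt h'
      · intro h
        have hx' : x ∈ s(s, t) := h ▸ Sym2.mem_mk_left x v
        rcases Sym2.mem_iff.1 hx' with h' | h'
        · exact hxs h'
        · exact hxt h'
    · obtain ⟨e, he, hze⟩ := hz₁
      rw [Finset.mem_singleton] at he; subst he
      exact Sym2.mem_iff.1 hze
  | @series E₁ E₂ a m b h₁ h₂ hd hV ha hb ih₁ ih₂ =>
    intro u v x huv hx
    have hx₁ : ∀ e ∈ E₁, x ∉ e := fun e he => hx e (Finset.mem_union_left _ he)
    have hx₂ : ∀ e ∈ E₂, x ∉ e := fun e he => hx e (Finset.mem_union_right _ he)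
    rcases Finset.mem_union.1 huv with huv | huv
    · -- the edge lies in the first part
      have hu : ∃ e ∈ E₁, u ∈ e := ⟨_, huv, Sym2.mem_mk_left u v⟩
      have hv : ∃ e ∈ E₁, v ∈ e := ⟨_, huv, Sym2.mem_mk_right u v⟩
      have key := IsTTSP.series (ih₁ huv hx₁) h₂ ?_ ?_ ?_ ?_
      · rw [Finset.union_right_comm] at key; exact key
      · rw [Finset.disjoint_union_left]
        refine ⟨hd, ?_⟩
        rw [Finset.disjoint_union_left, Finset.disjoint_singleton_left, Finset.disjoint_singleton_left]
        exact ⟨fun h => hx₂ _ h (Sym2.mem_mk_right u x), fun h => hx₂ _ h (Sym2.mem_mk_left x v)⟩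
      · intro z hz₁ hz₂
        rcases mem_span_union_apex hz₁ with hz | rfl | rfl | rfl
        · exact hV z hz hz₂
        · exact hV _ hu hz₂
        · obtain ⟨e, he, hxe⟩ := hz₂; exact absurd hxe (hx₂ e he)
        · exact hV _ hv hz₂
      · exact ha
      · intro e he
        rcases Finset.mem_union.1 he with he | he
        · exact hb e he
        · have hbx : b ≠ x := by
            obtain ⟨e', he', hbe'⟩ := h₂.right_mem
            intro hbx; exact hx₂ e' he' (hbx ▸ hbe')
          have hbu : b ≠ u := fun hbu => hb _ huv (hbu ▸ Sym2.mem_mk_left u v)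
          have hbv : b ≠ v := fun hbv => hb _ huv (hbv ▸ Sym2.mem_mk_right u v)
          rcases Finset.mem_union.1 he with he | he <;> rw [Finset.mem_singleton] at he <;> subst he
          · intro h; rcases Sym2.mem_iff.1 h with h | h
            · exact hbu h
            · exact hbx h
          · intro h; rcases Sym2.mem_iff.1 h with h | h
            · exact hbx h
            · exact hbv h
    · -- the edge lies in the second part
      have hu : ∃ e ∈ E₂, u ∈ e := ⟨_, huv, Sym2.mem_mk_left u v⟩
      have hv : ∃ e ∈ E₂, v ∈ e := ⟨_, huv, Sym2.mem_mk_right u v⟩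
      have key := IsTTSP.series h₁ (ih₂ huv hx₂) ?_ ?_ ?_ ?_
      · rw [← Finset.union_assoc] at key; exact key
      · rw [Finset.disjoint_union_right]
        refine ⟨hd, ?_⟩
        rw [Finset.disjoint_union_right, Finset.disjoint_singleton_right, Finset.disjoint_singleton_right]
        exact ⟨fun h => hx₁ _ h (Sym2.mem_mk_right u x), fun h => hx₁ _ h (Sym2.mem_mk_left x v)⟩
      · intro z hz₁ hz₂
        rcases mem_span_union_apex hz₂ with hz | rfl | rfl | rfl
        · exact hV z hz₁ hz
        · exact hV _ hz₁ hu
        · obtain ⟨e, he, hxe⟩ := hz₁; exact absurd hxe (hx₁ e he)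
        · exact hV _ hz₁ hv
      · intro e he
        rcases Finset.mem_union.1 he with he | he
        · exact ha e he
        · have hax : a ≠ x := by
            obtain ⟨e', he', hae'⟩ := h₁.left_mem
            intro hax; exact hx₁ e' he' (hax ▸ hae')
          have hau : a ≠ u := fun hau => ha _ huv (hau ▸ Sym2.mem_mk_left u v)
          have hav : a ≠ v := fun hav => ha _ huv (hav ▸ Sym2.mem_mk_right u v)
          rcases Finset.mem_union.1 he with he | he <;> rw [Finset.mem_singleton] at he <;> subst he
          · intro h; rcases Sym2.mem_iff.1 h with h | h
            · exact hau h
            · exact hax h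
          · intro h; rcases Sym2.mem_iff.1 h with h | h
            · exact hax h
            · exact hav h
      · exact hb
  | @parallel E₁ E₂ s t h₁ h₂ hd hV ih₁ ih₂ =>
    intro u v x huv hx
    have hx₁ : ∀ e ∈ E₁, x ∉ e := fun e he => hx e (Finset.mem_union_left _ he)
    have hx₂ : ∀ e ∈ E₂, x ∉ e := fun e he => hx e (Finset.mem_union_right _ he)
    rcases Finset.mem_union.1 huv with huv | huv
    · have hu : ∃ e ∈ E₁, u ∈ e := ⟨_, huv, Sym2.mem_mk_left u v⟩
      have hv : ∃ e ∈ E₁, v ∈ e := ⟨_, huv, Sym2.mem_mk_right u v⟩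
      have key := IsTTSP.parallel (ih₁ huv hx₁) h₂ ?_ ?_
      · rw [Finset.union_right_comm] at key; exact key
      · rw [Finset.disjoint_union_left]
        refine ⟨hd, ?_⟩
        rw [Finset.disjoint_union_left, Finset.disjoint_singleton_left, Finset.disjoint_singleton_left]
        exact ⟨fun h => hx₂ _ h (Sym2.mem_mk_right u x), fun h => hx₂ _ h (Sym2.mem_mk_left x v)⟩
      · intro z hz₁ hz₂
        rcases mem_span_union_apex hz₁ with hz | rfl | rfl | rfl
        · exact hV z hz hz₂
        · exact hV _ hu hz₂
        · obtain ⟨e, he, hxe⟩ := hz₂; exact absurd hxe (hx₂ e he)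
        · exact hV _ hv hz₂
    · have hu : ∃ e ∈ E₂, u ∈ e := ⟨_, huv, Sym2.mem_mk_left u v⟩
      have hv : ∃ e ∈ E₂, v ∈ e := ⟨_, huv, Sym2.mem_mk_right u v⟩
      have key := IsTTSP.parallel h₁ (ih₂ huv hx₂) ?_ ?_
      · rw [← Finset.union_assoc] at key; exact key
      · rw [Finset.disjoint_union_right]
        refine ⟨hd, ?_⟩
        rw [Finset.disjoint_union_right, Finset.disjoint_singleton_right, Finset.disjoint_singleton_right]
        exact ⟨fun h => hx₁ _ h (Sym2.mem_mk_right u x), fun h => hx₁ _ h (Sym2.mem_mk_left x v)⟩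
      · intro z hz₁ hz₂
        rcases mem_span_union_apex hz₂ with hz | rfl | rfl | rfl
        · exact hV z hz₁ hz
        · exact hV _ hz₁ hu
        · obtain ⟨e, he, hxe⟩ := hz₁; exact absurd hxe (hx₁ e he)
        · exact hV _ hz₁ hv

/-- **The apex as a terminal**: for a two-terminal series–parallel network `E` between `u` and `v` and a fresh vertex `x`, the edge
set `E ∪ {ux, xv}` is a two-terminal series–parallel network between `u` and `x` (`ux ∥ (E ∘ xv)`). [folklore] -/
theorem IsTTSP.apex_terminal {E : Finset (Sym2 V)} {u v x : V} (h : IsTTSP E u v) (hx : ∀ e ∈ E, x ∉ e) :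
    IsTTSP (E ∪ ({s(u, x)} ∪ {s(x, v)})) u x := by
  have hxu : x ≠ u := by
    obtain ⟨e, he, hue⟩ := h.left_mem
    intro hxu; exact hx e he (hxu ▸ hue)
  have hxv : x ≠ v := by
    obtain ⟨e, he, hve⟩ := h.right_mem
    intro hxv; exact hx e he (hxv ▸ hve)
  -- `E ∘ xv`: series composition at `v` of `E` (from `u` to `v`) and the edge `vx`
  have hser : IsTTSP (E ∪ {s(x, v)}) u x := by
    have hvx : IsTTSP ({s(v, x)} : Finset (Sym2 V)) v x := IsTTSP.edge hxv.symm
    rw [Sym2.eq_swap] at hvx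
    refine IsTTSP.series h hvx ?_ (fun z hz₁ hz₂ => ?_) (fun e he => ?_) (fun e he => ?_)
    · rw [Finset.disjoint_singleton_right]; exact fun h' => hx _ h' (Sym2.mem_mk_left x v)
    · obtain ⟨e, he, hze⟩ := hz₂
      rw [Finset.mem_singleton] at he; subst he
      rcases Sym2.mem_iff.1 hze with rfl | rfl
      · obtain ⟨e', he', hze'⟩ := hz₁; exact absurd hze' (hx e' he')
      · rfl
    · rw [Finset.mem_singleton] at he; subst he
      intro h'; rcases Sym2.mem_iff.1 h' with h' | h'
      · exact hxu h'.symm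
      · exact h.ne h'
    · exact hx e he
  -- in parallel with the edge `ux`
  have key := IsTTSP.parallel (IsTTSP.edge hxu.symm) hser ?_ ?_
  · -- rearrange the edge set
    have hset : ({s(u, x)} : Finset (Sym2 V)) ∪ (E ∪ {s(x, v)}) = E ∪ ({s(u, x)} ∪ {s(x, v)}) := by
      ext g; simp only [Finset.mem_union, Finset.mem_singleton]; tauto
    rw [hset] at key; exact key
  · rw [Finset.disjoint_singleton_left, Finset.mem_union, Finset.mem_singleton, not_or]
    refine ⟨fun h' => hx _ h' (Sym2.mem_mk_right u x), fun h' => ?_⟩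
    rcases Sym2.eq_iff.1 h' with ⟨h1, _⟩ | ⟨h1, _⟩
    · exact hxu h1.symm
    · exact h.ne h1
  · intro z hz₁ _
    obtain ⟨e, he, hze⟩ := hz₁
    rw [Finset.mem_singleton] at he; subst he
    exact Sym2.mem_iff.1 hze

end FK

end Summit.CriticalPhenomena.PercolationContinuityZ3.Theorems
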